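import Literature.AnabelianGeometry.SemiGraphs.SubgroupPresentationCosetGraph
import Literature.AnabelianGeometry.SemiGraphs.SemiGraphIsoTransport
import HarnessLib

/-!
# Coset semi-graphs under a surjection of the ambient group ([SemiAnbd] §3 p. 41)

Mochizuki, *Semi-graphs of anabelioids*, Publ. RIMS **42** (2006), §3 proof of Thm. 3.7 (iii) p. 41 ("this
action factors through a finite quotient"; the semi-graphs `𝒢_{∞,i}`, `𝔾_j` are read off the quotients
`Gal(𝒢_{∞,i}/𝒢)` of `π₁^temp(𝒢)`) [cite: MochizukiSemiAnbd2006, Thm 3.7(iii) p.41].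

PURE GROUP THEORY (cell row T54-B, tower third, file T3b; plan/GAP-LEDGER.md G-w4d053-1).  For a
surjection `f : Γ →* Γ'` the image presentation `P.map f` (vertex / edge subgroups and branch elements
pushed forward) and, for a level `K ≥ ker f`, the isomorphism of semi-graphs
`P.cosetGraph K ≅ (P.map f).cosetGraph (K.map f)` over `𝔾`, intertwining the deck actions
(`deckAct K g ↦ deckAct (K.map f) (f g)`).  This is the step "`H_w \ Π / K = f(H_w) \ (Π/ker f) / f(K)`"
that moves the coset model from `π₁^temp(𝒢)` to the Galois group `Aut(𝒢_{∞,n})` of a level, where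
the orbit-graph dictionary lives.  Nothing here bears on [IUTchIII] Cor. 3.12.
-/

namespace Literature.AnabelianGeometry.SemiGraphs

namespace SemiGraph

namespace SubgroupPresentation

open CategoryTheory

universe u

variable {𝔾 : SemiGraph.{u}} {Γ Γ' : Type u} [Group Γ] [Group Γ']
variable (P : SubgroupPresentation 𝔾 Γ) (f : Γ →* Γ')

/-- **The image presentation** under a homomorphism `f : Γ → Γ'`: `f(H_w)`, `f(M_e)`, `f(s_b)`.
[cite: MochizukiSemiAnbd2006, Thm 3.7(iii) p.41] -/
def map : SubgroupPresentation 𝔾 Γ' where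
  H w := (P.H w).map f
  M e := (P.M e).map f
  s b := f (P.s b)
  conj_mem b w hw := by
    rintro _ ⟨m, hm, rfl⟩
    exact ⟨P.s b * m * (P.s b)⁻¹, P.conj_mem b w hw m hm, by simp⟩

/-- The vertex subgroups of the image presentation. [cite: MochizukiSemiAnbd2006, Thm 3.7(iii) p.41] -/
@[simp] theorem map_H (w : 𝔾.Vertex) : (P.map f).H w = (P.H w).map f := rfl

/-- The edge subgroups of the image presentation. [cite: MochizukiSemiAnbd2006, Thm 3.7(iii) p.41] -/
@[simp] theorem map_M (e : 𝔾.Edge) : (P.map f).M e = (P.M e).map f := rfl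

/-- The branch elements of the image presentation. [cite: MochizukiSemiAnbd2006, Thm 3.7(iii) p.41] -/
@[simp] theorem map_s (b : 𝔾.Branch) : (P.map f).s b = f (P.s b) := rfl

variable (K : Subgroup Γ)

/-- Pushing forward a double coset relation along `f`. [folklore] -/
private theorem mk_map_eq_of_mk_eq (L : Subgroup Γ) {y y' : Γ}
    (h : DoubleCoset.mk L K y = DoubleCoset.mk L K y') :
    DoubleCoset.mk (L.map f) (K.map f) (f y) = DoubleCoset.mk (L.map f) (K.map f) (f y') := by
  obtain ⟨a, ha, c, hc, rfl⟩ := (DoubleCoset.eq _ _ _ _).mp h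
  exact (DoubleCoset.eq _ _ _ _).mpr ⟨f a, ⟨a, ha, rfl⟩, f c, ⟨c, hc, rfl⟩, by simp⟩

/-- Pulling back a double coset relation along `f` when `ker f ≤ K`. [folklore] -/
private theorem mk_eq_of_mk_map_eq (hK : f.ker ≤ K) (L : Subgroup Γ) {y y' : Γ}
    (h : DoubleCoset.mk (L.map f) (K.map f) (f y) = DoubleCoset.mk (L.map f) (K.map f) (f y')) :
    DoubleCoset.mk L K y = DoubleCoset.mk L K y' := by
  obtain ⟨_, ⟨a, ha, rfl⟩, _, ⟨c, hc, rfl⟩, hy⟩ := (DoubleCoset.eq _ _ _ _).mp h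
  -- `f y' = f (a y c)`, so `y' = a y c n` with `n ∈ ker f ≤ K`
  have hn : (a * y * c)⁻¹ * y' ∈ f.ker := by
    rw [MonoidHom.mem_ker, map_mul, map_inv, hy, map_mul, map_mul, inv_mul_cancel]
  refine (DoubleCoset.eq _ _ _ _).mpr ⟨a, ha, c * ((a * y * c)⁻¹ * y'), mul_mem hc (hK hn), ?_⟩
  group

/-- **The comparison morphism `P.cosetGraph K ⟶ (P.map f).cosetGraph (K.map f)`** (`y ↦ f y`), over `𝔾`.
[cite: MochizukiSemiAnbd2006, Thm 3.7(iii) p.41] -/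
def cosetGraphMapHom : P.cosetGraph K ⟶ (P.map f).cosetGraph (K.map f) where
  vertexMap x := ⟨x.1, Quotient.liftOn' x.2 (fun y => DoubleCoset.mk ((P.map f).H x.1) (K.map f) (f y))
    (fun y y' h => mk_map_eq_of_mk_eq f K (P.H x.1) (Quotient.sound' h))⟩
  edgeMap x := ⟨x.1, Quotient.liftOn' x.2 (fun y => DoubleCoset.mk ((P.map f).M x.1) (K.map f) (f y))
    (fun y y' h => mk_map_eq_of_mk_eq f K (P.M x.1) (Quotient.sound' h))⟩
  branchMap p := ⟨(p.1.1, ⟨p.1.2.1, Quotient.liftOn' p.1.2.2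
    (fun y => DoubleCoset.mk ((P.map f).M p.1.2.1) (K.map f) (f y))
    (fun y y' h => mk_map_eq_of_mk_eq f K (P.M p.1.2.1) (Quotient.sound' h))⟩), p.2⟩
  edgeOf_branchMap _ := rfl
  branchMap_injOn := by
    rintro ⟨⟨b₁, E₁⟩, h₁⟩ ⟨⟨b₂, E₂⟩, h₂⟩ (hE : E₁ = E₂) h
    subst hE
    have hb : b₁ = b₂ :=
      congrArg (fun p : ((P.map f).cosetGraph (K.map f)).Branch => p.1.1) h
    subst hb
    rfl
  abuts_branchMap := by
    intro p x hx
    obtain ⟨b, y, rfl⟩ := P.bMk_surjective K p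
    rcases hab : 𝔾.abuts b with _ | w
    · rw [P.cosetGraph_abuts_bMk_none K b hab y] at hx
      exact absurd hx (by simp)
    · rw [P.cosetGraph_abuts_bMk K b w hab y] at hx
      cases hx
      change ((P.map f).cosetGraph (K.map f)).abuts ((P.map f).bMk (K.map f) b (f y)) =
        some ((P.map f).vMk (K.map f) w (f (P.s b * y)))
      rw [(P.map f).cosetGraph_abuts_bMk (K.map f) b w hab (f y), map_mul]
      rfl

/-- The comparison morphism on vertex representatives. [cite: MochizukiSemiAnbd2006, Thm 3.7(iii) p.41] -/
@[simp] theorem cosetGraphMapHom_vertexMap_vMk (w : 𝔾.Vertex) (y : Γ) :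
    (P.cosetGraphMapHom f K).vertexMap (P.vMk K w y) = (P.map f).vMk (K.map f) w (f y) := rfl

/-- The comparison morphism on edge representatives. [cite: MochizukiSemiAnbd2006, Thm 3.7(iii) p.41] -/
@[simp] theorem cosetGraphMapHom_edgeMap_eMk (e : 𝔾.Edge) (y : Γ) :
    (P.cosetGraphMapHom f K).edgeMap (P.eMk K e y) = (P.map f).eMk (K.map f) e (f y) := rfl

/-- The comparison morphism on branch representatives. [cite: MochizukiSemiAnbd2006, Thm 3.7(iii) p.41] -/
@[simp] theorem cosetGraphMapHom_branchMap_bMk (b : 𝔾.Branch) (y : Γ) :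
    (P.cosetGraphMapHom f K).branchMap (P.bMk K b y) = (P.map f).bMk (K.map f) b (f y) := rfl

/-- The comparison morphism is over `𝔾`. [cite: MochizukiSemiAnbd2006, Thm 3.7(iii) p.41] -/
theorem cosetGraphMapHom_comp_proj :
    P.cosetGraphMapHom f K ≫ (P.map f).cosetGraphProj (K.map f) = P.cosetGraphProj K := by
  refine SemiGraph.hom_ext _ _ ?_ ?_ ?_ <;> rfl

variable {f K}

/-- The comparison morphism is bijective on vertices (`f` surjective, `ker f ≤ K`).
[cite: MochizukiSemiAnbd2006, Thm 3.7(iii) p.41] -/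
theorem cosetGraphMapHom_vertexMap_bijective (hf : Function.Surjective f) (hK : f.ker ≤ K) :
    Function.Bijective (P.cosetGraphMapHom f K).vertexMap := by
  constructor
  · intro x x' h
    obtain ⟨w, y, rfl⟩ := P.vMk_surjective K x
    obtain ⟨w', y', rfl⟩ := P.vMk_surjective K x'
    simp only [cosetGraphMapHom_vertexMap_vMk] at h
    obtain ⟨rfl, hq⟩ := Sigma.mk.inj_iff.mp h
    exact congrArg (Sigma.mk w) (mk_eq_of_mk_map_eq f K hK (P.H w) (eq_of_heq hq))
  · intro x
    obtain ⟨w, y', rfl⟩ := (P.map f).vMk_surjective (K.map f) x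
    obtain ⟨y, rfl⟩ := hf y'
    exact ⟨P.vMk K w y, rfl⟩

/-- The comparison morphism is bijective on edges. [cite: MochizukiSemiAnbd2006, Thm 3.7(iii) p.41] -/
theorem cosetGraphMapHom_edgeMap_bijective (hf : Function.Surjective f) (hK : f.ker ≤ K) :
    Function.Bijective (P.cosetGraphMapHom f K).edgeMap := by
  constructor
  · intro x x' h
    obtain ⟨e, y, rfl⟩ := P.eMk_surjective K x
    obtain ⟨e', y', rfl⟩ := P.eMk_surjective K x'
    simp only [cosetGraphMapHom_edgeMap_eMk] at h
    obtain ⟨rfl, hq⟩ := Sigma.mk.inj_iff.mp h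
    exact congrArg (Sigma.mk e) (mk_eq_of_mk_map_eq f K hK (P.M e) (eq_of_heq hq))
  · intro x
    obtain ⟨e, y', rfl⟩ := (P.map f).eMk_surjective (K.map f) x
    obtain ⟨y, rfl⟩ := hf y'
    exact ⟨P.eMk K e y, rfl⟩

/-- The comparison morphism is bijective on branches. [cite: MochizukiSemiAnbd2006, Thm 3.7(iii) p.41] -/
theorem cosetGraphMapHom_branchMap_bijective (hf : Function.Surjective f) (hK : f.ker ≤ K) :
    Function.Bijective (P.cosetGraphMapHom f K).branchMap := by
  constructor
  · intro x x' h
    obtain ⟨b, y, rfl⟩ := P.bMk_surjective K x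
    obtain ⟨b', y', rfl⟩ := P.bMk_surjective K x'
    simp only [cosetGraphMapHom_branchMap_bMk] at h
    have hb : b = b' := congrArg (fun p : ((P.map f).cosetGraph (K.map f)).Branch => p.1.1) h
    subst hb
    have hq : DoubleCoset.mk ((P.map f).M (𝔾.edgeOf b)) (K.map f) (f y) =
        DoubleCoset.mk ((P.map f).M (𝔾.edgeOf b)) (K.map f) (f y') :=
      eq_of_heq (Sigma.mk.inj_iff.mp
        (congrArg (fun p : ((P.map f).cosetGraph (K.map f)).Branch => p.1.2) h)).2
    exact Subtype.ext (Prod.ext rfl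
      (congrArg (Sigma.mk (𝔾.edgeOf b)) (mk_eq_of_mk_map_eq f K hK (P.M _) hq)))
  · intro x
    obtain ⟨b, y', rfl⟩ := (P.map f).bMk_surjective (K.map f) x
    obtain ⟨y, rfl⟩ := hf y'
    exact ⟨P.bMk K b y, rfl⟩

/-- **`P.cosetGraph K ≅ (P.map f).cosetGraph (K.map f)`** for `f` surjective with `ker f ≤ K` (so in
particular `P.cosetGraph (ker f) ≅ (P.map f).cosetGraph ⊥`: the coset semi-graph at a normal level IS
the coset semi-graph of the image presentation in the quotient). [cite: MochizukiSemiAnbd2006, Thm 3.7(iii) p.41] -/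
noncomputable def cosetGraphMapIso (hf : Function.Surjective f) (hK : f.ker ≤ K) :
    P.cosetGraph K ≅ (P.map f).cosetGraph (K.map f) :=
  SemiGraph.Hom.isoOfBijective (P.cosetGraphMapHom f K) (P.cosetGraphMapHom_vertexMap_bijective hf hK)
    (P.cosetGraphMapHom_edgeMap_bijective hf hK) (P.cosetGraphMapHom_branchMap_bijective hf hK)
    (by
      intro p hp
      obtain ⟨b, y, rfl⟩ := P.bMk_surjective K p
      rcases hab : 𝔾.abuts b with _ | w
      · rw [cosetGraphMapHom_branchMap_bMk]
        exact (P.map f).cosetGraph_abuts_bMk_none (K.map f) b hab (f y)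
      · rw [P.cosetGraph_abuts_bMk K b w hab y] at hp
        exact absurd hp (by simp))

/-- The `hom` of the comparison isomorphism. [cite: MochizukiSemiAnbd2006, Thm 3.7(iii) p.41] -/
@[simp] theorem cosetGraphMapIso_hom (hf : Function.Surjective f) (hK : f.ker ≤ K) :
    (P.cosetGraphMapIso hf hK).hom = P.cosetGraphMapHom f K := rfl

/-- **The comparison intertwines the deck actions**: `deckAct K g` corresponds to
`deckAct (K.map f) (f g)`. [cite: MochizukiSemiAnbd2006, Thm 3.7(iii) p.41] -/
theorem deckAct_comp_cosetGraphMapHom [K.Normal] [(K.map f).Normal] (g : Γ) :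
    (P.deckAct K g).hom ≫ P.cosetGraphMapHom f K =
      P.cosetGraphMapHom f K ≫ ((P.map f).deckAct (K.map f) (f g)).hom := by
  refine P.hom_ext_mk K _ _ (fun w y => ?_) (fun e y => ?_) (fun b y => ?_)
  · change (P.cosetGraphMapHom f K).vertexMap (P.vMk K w (y * g⁻¹)) =
      ((P.map f).deckAct (K.map f) (f g)).hom.vertexMap ((P.map f).vMk (K.map f) w (f y))
    rw [cosetGraphMapHom_vertexMap_vMk, deckAct_vertexMap_vMk, map_mul, map_inv]
  · change (P.cosetGraphMapHom f K).edgeMap (P.eMk K e (y * g⁻¹)) =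
      ((P.map f).deckAct (K.map f) (f g)).hom.edgeMap ((P.map f).eMk (K.map f) e (f y))
    rw [cosetGraphMapHom_edgeMap_eMk, deckAct_edgeMap_eMk, map_mul, map_inv]
  · change (P.cosetGraphMapHom f K).branchMap (P.bMk K b (y * g⁻¹)) =
      ((P.map f).deckAct (K.map f) (f g)).hom.branchMap ((P.map f).bMk (K.map f) b (f y))
    rw [cosetGraphMapHom_branchMap_bMk, deckAct_branchMap_bMk, map_mul, map_inv]

/-- Normality of the image level (for use with `deckAct_comp_cosetGraphMapHom`).
[cite: MochizukiSemiAnbd2006, Thm 3.7(iii) p.41] -/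
theorem map_level_normal [K.Normal] (hf : Function.Surjective f) : (K.map f).Normal :=
  Subgroup.Normal.map ‹K.Normal› f hf

end SubgroupPresentation

end SemiGraph

end Literature.AnabelianGeometry.SemiGraphs
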